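import Mathlib

/-!
# Venture HSemireg — (S3)(H1), second route, part 4: a (1,1) SECANT FRAME HAS SIGNATURE `(n,n)` IFF `b` IS NON-DEGENERATE — the index never enters

HONEST FRAMING. Part of the Lean index of the computation cell `pub-hsemireg` (TRACK «S4-PUSH» (ii), seat s4-prove-3,
SECOND proof route; work log `s4push/prove-3/ATTEMPT-1.md` §3 / ATTEMPT-2).  LINEAR ALGEBRA OF FOUR COORDINATE BLOCKS over a
field ONLY: no abelian variety, no Hodge structure, no spinor, no sheaf is constructed; nothing here says that HC, HC_CM or HC_AV
holds; no Literature fact is declared or used.  This file makes KERNEL the one paper step of the COUNTER-MODEL in parts 1–2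
(«(H1) `∫_X bⁿ > 0` is NOT implied by the Weil-structure axioms: signature `(n,n)` holds for EVERY index of `b`»), stated
independently on paper by s4-prove-1 (ATTEMPT-1 §3) and by this seat (ATTEMPT-1 §3) — now ×2 paper + kernel.

DICTIONARY (on paper; FORMULA-N-th7 §A.1 / Def. A.2 (ii)).  `U = H¹(X,ℂ) = U₁ ⊕ U₂` (`U₁ = U^{1,0}`, `U₂ = U^{0,1}`, bases `e_j`,
`ē_k`, `dim = n` each), `V = U ⊕ U^*` with `U^* = U₁^* ⊕ U₂^*`; coordinates `(u₁, u₂, θ₁, θ₂)` = the type `V4 K n`.  A (1,1)-class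
`B = Σ_{j,k} β_{jk} e_j ∧ ē_k` is a matrix `β`; contraction gives `ι_Θ B = (-β θ₂, βᵀ θ₁)` for `Θ = (θ₁, θ₂)`, and the null space
of the pure spinor `e^B` is the graph `W_B = ann(e^B) = {(-ι_Θ B, Θ)} = {(β θ₂, -βᵀ θ₁, θ₁, θ₂)}` (two lines: `(u + ι_Θ)e^B =
(u + ι_Θ B) ∧ e^B`); it is the range of `nullMap β`.  `N := V^{0,1} = U^{0,1} ⊕ Ann(U^{0,1}) = {(0, u₂, θ₁, 0)}` (th-7 A.1: `HT¹ = N`,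
`Ann(U^{0,1}) = (U^{1,0})^* = T₀X`) is `NSub`.  For the secant frame `B = a + √-d·b`, `B̄ = a - √-d·b` (`a, b` REAL (1,1)-classes
with matrices `α`, `b`) the two matrices are `β = α + s·b`, `β' = α - s·b`, `s = √-d` — conjugation acts by `s ↦ -s` (on paper).
th-7's Weil-type condition D8 / A.2 (ii) is «`N = (N ∩ W_B) ⊕ (N ∩ W_B̄)` ⟺ signature `(n,n)`».

CONTENT (all PROVED, 0 sorry; namespace `Summit.Ventures.HSemireg.Mod4Sign`; any field `K`):
* `mem_N_and_range_nullMap_iff`, `finrank_N_inf_W` — **`N ∩ W_B = {(0, -βᵀθ₁, θ₁, 0)}` has dimension `n` for EVERY matrix `β`**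
  (no condition whatsoever: `ι_Θ B ∈ U^{0,1}` automatically for `Θ ∈ Ann(U^{0,1})` and `B` of type (1,1));
* `nullN_eq_nullN_iff`, `range_nullN_disjoint_iff` — the two pieces for `β, β'` meet in `ker (β - β')ᵀ`; they are DISJOINT iff
  `det(β - β') ≠ 0`;
* `finrank_NSub` (`dim N = 2n`), `sup_eq_N_and_disjoint_iff` — **`N = (N ∩ W_β) ⊕ (N ∩ W_β')` iff `det(β - β') ≠ 0`**;
* `secantFrame_signature_iff` — for the secant frame (`β - β' = 2s·b`, `2s ≠ 0`): **signature `(n,n)` ⟺ `det b ≠ 0` ⟺ `b`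
  non-degenerate — the INDEX / SIGNATURE of `b` never enters**; `example`: `n = 4`, `a = 0`, `b = diag(1,1,1,-1)` (index 1, the
  `E⁴` counter-model of parts 1–2, where `∫_X b⁴ = -24 < 0`) IS a signature-(4,4) secant frame.
So the Weil-structure axioms of STRUCTURE §1.0 / D8 are satisfied by frames of every index, and (S3)'s (H1) («ind(b) even», parts 1–2)
is an independent binder.  What is NOT here: that `W_B`, `W_B̄` are the `±√-d`-eigenspaces of an `η ∈ End(X × X̂)_ℚ` (Hodge
endomorphism ⇒ abelian-variety endomorphism), the rationality of `P`, polarisability of `(X × X̂, η)` — on paper in ATTEMPT-1 §3.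

All statements and proofs: s4-prove-3 (2026-08-23).
-/

namespace Summit.Ventures.HSemireg.Mod4Sign

section Frame

variable (K : Type*) [Field K] (n : ℕ)

/-- `V = U ⊕ U^* = (U₁ ⊕ U₂) ⊕ (U₁^* ⊕ U₂^*)` in coordinates: `(u₁, u₂, θ₁, θ₂)`, `U₁ = U^{1,0}`, `U₂ = U^{0,1}`. -/
abbrev V4 : Type _ := (Fin n → K) × (Fin n → K) × (Fin n → K) × (Fin n → K)

variable {K n}

/-- the null space `W_B = ann(e^B) = {(-ι_Θ B, Θ)}` of the pure spinor `e^B`, `B = Σ β_jk e_j ∧ ē_k` of type (1,1):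
`Θ = (θ₁, θ₂) ↦ (β θ₂, -βᵀ θ₁, θ₁, θ₂)`. -/
def nullMap (β : Matrix (Fin n) (Fin n) K) : ((Fin n → K) × (Fin n → K)) →ₗ[K] V4 K n where
  toFun Θ := (β.mulVec Θ.2, -(β.transpose.mulVec Θ.1), Θ.1, Θ.2)
  map_add' x y := by
    simp only [Prod.fst_add, Prod.snd_add, Matrix.mulVec_add, neg_add, Prod.mk_add_mk]
  map_smul' c x := by
    simp only [Prod.smul_fst, Prod.smul_snd, Matrix.mulVec_smul, RingHom.id_apply, Prod.smul_mk, smul_neg]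

/-- `N = V^{0,1} = U^{0,1} ⊕ Ann(U^{0,1}) = {(0, u₂, θ₁, 0)}`. -/
def NSub : Submodule K (V4 K n) where
  carrier := {x | x.1 = 0 ∧ x.2.2.2 = 0}
  add_mem' := by
    rintro x y ⟨hx1, hx2⟩ ⟨hy1, hy2⟩
    exact ⟨by simp [hx1, hy1], by simp [hx2, hy2]⟩
  zero_mem' := ⟨rfl, rfl⟩
  smul_mem' := by
    rintro c x ⟨hx1, hx2⟩
    exact ⟨by simp [hx1], by simp [hx2]⟩

/-- the parametrisation of `N ∩ W_B`: `θ₁ ↦ (0, -βᵀθ₁, θ₁, 0)`. -/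
def nullN (β : Matrix (Fin n) (Fin n) K) : (Fin n → K) →ₗ[K] V4 K n where
  toFun θ := (0, -(β.transpose.mulVec θ), θ, 0)
  map_add' x y := by simp [Matrix.mulVec_add, add_comm]
  map_smul' c x := by simp [Matrix.mulVec_smul, smul_neg]

/-- `nullN β` is injective (read off the third coordinate). -/
theorem nullN_injective (β : Matrix (Fin n) (Fin n) K) : Function.Injective (nullN β) := by
  intro x y h
  have := congrArg (fun v : V4 K n => v.2.2.1) h
  simpa [nullN] using this

/-- **`N ∩ W_B` is exactly the image of `nullN β`** — for EVERY matrix `β` (no condition on `β` at all): an element of `V`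
lies in `N` and in `W_B` iff it is `(0, -βᵀθ₁, θ₁, 0)` for some `θ₁`. -/
theorem mem_N_and_range_nullMap_iff (β : Matrix (Fin n) (Fin n) K) (x : V4 K n) :
    (x ∈ NSub ∧ x ∈ LinearMap.range (nullMap β)) ↔ x ∈ LinearMap.range (nullN β) := by
  constructor
  · rintro ⟨⟨-, h2⟩, ⟨⟨θ₁, θ₂⟩, rfl⟩⟩
    -- θ₂ = 0 from the last coordinate
    simp only [nullMap, LinearMap.coe_mk, AddHom.coe_mk] at h2
    subst h2
    exact ⟨θ₁, by simp [nullN, nullMap]⟩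
  · rintro ⟨θ, rfl⟩
    refine ⟨⟨rfl, rfl⟩, ⟨(θ, 0), ?_⟩⟩
    simp [nullN, nullMap]

/-- hence **`dim (N ∩ W_B) = n` for every `β`** («signature `(n,n)`» is automatic for a (1,1) secant frame). -/
theorem finrank_N_inf_W (β : Matrix (Fin n) (Fin n) K) :
    Module.finrank K ↥(NSub ⊓ LinearMap.range (nullMap β) : Submodule K (V4 K n)) = n := by
  have h : (NSub ⊓ LinearMap.range (nullMap β) : Submodule K (V4 K n)) = LinearMap.range (nullN β) := by
    ext x
    exact mem_N_and_range_nullMap_iff β x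
  rw [h, LinearMap.finrank_range_of_inj (nullN_injective β), Module.finrank_fin_fun]

/-- the intersection of the two pieces: `(0,-βᵀθ,θ,0) = (0,-β'ᵀθ',θ',0)` iff `θ = θ'` and `(β - β')ᵀ θ = 0`. -/
theorem nullN_eq_nullN_iff (β β' : Matrix (Fin n) (Fin n) K) (θ θ' : Fin n → K) :
    nullN β θ = nullN β' θ' ↔ θ = θ' ∧ (β - β').transpose.mulVec θ = 0 := by
  constructor
  · intro h
    have h3 := congrArg (fun v : V4 K n => v.2.2.1) h
    have h2 := congrArg (fun v : V4 K n => v.2.1) h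
    simp only [nullN, LinearMap.coe_mk, AddHom.coe_mk] at h3 h2
    subst h3
    refine ⟨rfl, ?_⟩
    rw [Matrix.transpose_sub, Matrix.sub_mulVec, sub_eq_zero]
    exact neg_injective h2
  · rintro ⟨rfl, h⟩
    rw [Matrix.transpose_sub, Matrix.sub_mulVec, sub_eq_zero] at h
    simp [nullN, h]

/-- **TRANSVERSALITY ⟺ NON-DEGENERACY (no index condition):** the two `n`-dimensional pieces `N ∩ W_B`, `N ∩ W_{B'}` meet
only in `0` iff `(β - β')ᵀ` has trivial kernel, i.e. iff `det(β - β') ≠ 0`; for the secant frame `B = a + s·b`, `B̄ = a - s·b`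
this is `det(2s·b) ≠ 0` ⟺ `b` NON-DEGENERATE — the SIGNATURE / INDEX of `b` never enters. -/
theorem range_nullN_disjoint_iff (β β' : Matrix (Fin n) (Fin n) K) :
    Disjoint (LinearMap.range (nullN β)) (LinearMap.range (nullN β')) ↔ (β - β').det ≠ 0 := by
  rw [Submodule.disjoint_def]
  constructor
  · intro h hdet
    -- a non-zero kernel vector of (β - β')ᵀ
    rw [← Matrix.det_transpose] at hdet
    obtain ⟨θ, hθ0, hθ⟩ := Matrix.exists_mulVec_eq_zero_iff.mpr hdet
    have hmem : nullN β θ ∈ LinearMap.range (nullN β') := by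
      refine ⟨θ, ?_⟩
      exact ((nullN_eq_nullN_iff β β' θ θ).mpr ⟨rfl, hθ⟩).symm
    have := h _ ⟨θ, rfl⟩ hmem
    exact hθ0 (nullN_injective β (by rw [this, map_zero]))
  · intro hdet x ⟨θ, hθ⟩ ⟨θ', hθ'⟩
    have h := (nullN_eq_nullN_iff β β' θ θ').mp (hθ.trans hθ'.symm)
    obtain ⟨rfl, hker⟩ := h
    have hθ0 : θ = 0 := by
      rw [← Matrix.det_transpose] at hdet
      by_contra hne
      exact hdet (Matrix.exists_mulVec_eq_zero_iff.mp ⟨θ, hne, hker⟩)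
    rw [← hθ, hθ0, map_zero]

/-- the parametrisation of `N`: `(u₂, θ₁) ↦ (0, u₂, θ₁, 0)`. -/
def NMap : ((Fin n → K) × (Fin n → K)) →ₗ[K] V4 K n where
  toFun p := (0, p.1, p.2, 0)
  map_add' x y := by simp
  map_smul' c x := by simp

/-- `NMap` is injective. -/
theorem NMap_injective : Function.Injective (NMap (K := K) (n := n)) := by
  intro x y h
  have h1 := congrArg (fun v : V4 K n => v.2.1) h
  have h2 := congrArg (fun v : V4 K n => v.2.2.1) h
  simp only [NMap, LinearMap.coe_mk, AddHom.coe_mk] at h1 h2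
  exact Prod.ext h1 h2

/-- `N` is the range of `NMap`. -/
theorem range_NMap : LinearMap.range (NMap (K := K) (n := n)) = NSub := by
  ext x
  constructor
  · rintro ⟨p, rfl⟩
    exact ⟨rfl, rfl⟩
  · rintro ⟨h1, h2⟩
    refine ⟨(x.2.1, x.2.2.1), ?_⟩
    obtain ⟨a, b, c, d⟩ := x
    simp only at h1 h2
    subst h1; subst h2
    rfl

/-- `dim N = 2n`. -/
theorem finrank_NSub : Module.finrank K ↥(NSub : Submodule K (V4 K n)) = 2 * n := by
  rw [← range_NMap, LinearMap.finrank_range_of_inj NMap_injective, Module.finrank_prod, Module.finrank_fin_fun]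
  ring

/-- `N ∩ W_B ≤ N`. -/
theorem range_nullN_le (β : Matrix (Fin n) (Fin n) K) : LinearMap.range (nullN β) ≤ (NSub : Submodule K (V4 K n)) := by
  rintro x ⟨θ, rfl⟩
  exact ⟨rfl, rfl⟩

/-- **SIGNATURE `(n,n)` ⟺ NON-DEGENERACY:** `N = (N ∩ W_B) ⊕ (N ∩ W_{B'})` (the two `n`-dimensional pieces are complementary
inside the `2n`-dimensional `N`) iff `det(β - β') ≠ 0` — th-7's «N = (N∩W₁) ⊕ (N∩W₂) ⟺ signature (n,n)» holds for EVERY pair of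
(1,1) null spaces with `β - β'` invertible; no positivity / index condition on `β - β'` appears. -/
theorem sup_eq_N_and_disjoint_iff (β β' : Matrix (Fin n) (Fin n) K) :
    (LinearMap.range (nullN β) ⊔ LinearMap.range (nullN β') = (NSub : Submodule K (V4 K n)) ∧
      Disjoint (LinearMap.range (nullN β)) (LinearMap.range (nullN β'))) ↔ (β - β').det ≠ 0 := by
  constructor
  · exact fun h => (range_nullN_disjoint_iff β β').mp h.2
  · intro hdet
    have hdis := (range_nullN_disjoint_iff β β').mpr hdet
    refine ⟨?_, hdis⟩
    apply Submodule.eq_of_le_of_finrank_eq (sup_le (range_nullN_le β) (range_nullN_le β'))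
    have hsum := Submodule.finrank_sup_add_finrank_inf_eq (LinearMap.range (nullN β)) (LinearMap.range (nullN β'))
    rw [hdis.eq_bot, finrank_bot, add_zero, LinearMap.finrank_range_of_inj (nullN_injective β),
      LinearMap.finrank_range_of_inj (nullN_injective β'), Module.finrank_fin_fun] at hsum
    rw [finrank_NSub, hsum]
    ring

/-- **THE SECANT FRAME.**  For `B = a + s·b`, `B̄ = a - s·b` (`a, b` real (1,1)-classes with matrices `α, b`, `s = √-d`):
`β - β' = (2s)·b`, so — for `2s ≠ 0` — the two pieces are complementary in `N` («signature (n,n)», th-7 Def. A.2 (ii) / D8)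
**iff `det b ≠ 0`, i.e. iff `b` is NON-DEGENERATE; the index of `b` never enters.** -/
theorem secantFrame_signature_iff (α b : Matrix (Fin n) (Fin n) K) {s : K} (hs : (2 : K) * s ≠ 0) :
    (LinearMap.range (nullN (α + s • b)) ⊔ LinearMap.range (nullN (α - s • b)) = (NSub : Submodule K (V4 K n)) ∧
      Disjoint (LinearMap.range (nullN (α + s • b))) (LinearMap.range (nullN (α - s • b)))) ↔ b.det ≠ 0 := by
  rw [sup_eq_N_and_disjoint_iff, show α + s • b - (α - s • b) = ((2 : K) * s) • b by module, Matrix.det_smul,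
    mul_ne_zero_iff, Fintype.card_fin]
  exact ⟨fun h => h.2, fun h => ⟨pow_ne_zero _ hs, h⟩⟩

/-- THE COUNTER-MODEL'S FRAME IS A GENUINE SIGNATURE-(4,4) SECANT FRAME: `n = 4`, `a = 0`, `b = diag(1,1,1,-1)` (on paper
`X = E⁴`, `b = e₁ + e₂ + e₃ - e₄`, index 1), any `s` with `2s ≠ 0` (e.g. `s = i`, `K ⊇ ℚ(i)`): `det b = -1 ≠ 0`, so
`N = (N ∩ W_B) ⊕ (N ∩ W_B̄)` — while part 2's `example` gives `∫_X b⁴ = 4!·(-1) < 0`: (H1) fails on a frame satisfying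
every axiom of D8. -/
example {s : K} (hs : (2 : K) * s ≠ 0) :
    LinearMap.range (nullN ((0 : Matrix (Fin 4) (Fin 4) K) + s • Matrix.diagonal ![1, 1, 1, -1])) ⊔
        LinearMap.range (nullN ((0 : Matrix (Fin 4) (Fin 4) K) - s • Matrix.diagonal ![1, 1, 1, -1])) = NSub ∧
      Disjoint (LinearMap.range (nullN ((0 : Matrix (Fin 4) (Fin 4) K) + s • Matrix.diagonal ![1, 1, 1, -1])))
        (LinearMap.range (nullN ((0 : Matrix (Fin 4) (Fin 4) K) - s • Matrix.diagonal ![1, 1, 1, -1]))) := by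
  rw [secantFrame_signature_iff _ _ hs, Matrix.det_diagonal, Fin.prod_univ_four]
  simp

end Frame

end Summit.Ventures.HSemireg.Mod4Sign
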